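import Summits.CriticalPhenomena.PercolationContinuityZ3.Theorems.SahiCISNonClosureLaws

/-!
# CIS in the kernel sense is NOT closed under weak convergence in dimension `3` — II: the non-closure theorem

Cell `prim-sahi`, typer (generation 17); `--supports stmt-CriticalPhenomena-4575`.  No named facts, no sorries.
Continuation of `SahiCISNonClosureLaws.lean` (the four-atom laws `fourAtomLaw s t` on `Q_3`, CIS with everywhere
stochastically increasing kernels for `s < t`):

* `not_isCISae_fourAtomLaw_self` — for `s = t` the law is NOT `IsCISae 3` (a fortiori admits no everywhere-monotone
  kernels): the merged conditioning atoms `(s, ¼) ≤ (s, ¾)` carry the conditional laws `δ_1`, `δ_0` of `X₂`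
  (`kernel_at_pt14`, `kernel_at_pt34`, read off ANY disintegration kernel at the atoms) and form an atom of
  `μ^{(2)} ⊗ μ^{(2)}`.
* `tendsto_fourAtomLaw` — `(s,t) ↦ fourAtomLaw s t` is weakly continuous (atoms move continuously); hence
  **`exists_isCISae_tendsto_not_isCISae`: the CIS laws `fourAtomLaw 0 (1/(n+1))` converge weakly to the non-CIS law
  `fourAtomLaw 0 0`.**  Colangelo–Müller–Scarsini's Theorem 5 (weak closure) is therefore a statement about their
  Definition 4 only, which in dimension `≥ 3` is strictly weaker than CIS (`SahiCISDefinitionFour.lean`); in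
  dimension `2` (one conditioning coordinate) CIS = cut-TP₂ is weakly closed (`CISWeakClosure.lean`,
  `SahiTP2CIS.lean`).  Positive association and order-`n` Sahi positivity ARE weakly closed
  (`PositiveAssociationLimits`, `SahiPositivityWeakLimits.lean`), so weak limits of CIS laws keep those consequences.

References: Colangelo–Müller–Scarsini 2006, §4 Thm. 4 (b), Thm. 5 [ColangeloMullerScarsini2006]; Müller–Stoyan 2002,
Def. 3.10.9 [MullerStoyan2002].  The example is this work.
-/

noncomputable section

namespace Summit.CriticalPhenomena.PercolationContinuityZ3.Theorems.SahiCIS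

open MeasureTheory ProbabilityTheory Set Filter Topology Function
open Summit.CriticalPhenomena.PercolationContinuityZ3.Theorems.SahiBoxTP2
open scoped ENNReal unitInterval BoundedContinuousFunction

/-! ### Not CIS for `s = t` -/

section Self

/-- Evaluation of the law of `((X₀,X₁),X₂)` for `s = t` on a measurable set. [this work] -/
theorem fourAtomLaw_self_map_initLast_apply (s : I) {S : Set ((Fin 2 → I) × I)} (hS : MeasurableSet S) :
    (fourAtomLaw s s).map initLast S =
      2⁻¹ * (2⁻¹ * (S.indicator 1 ((![s, ⊥] : Fin 2 → I), (⊥ : I)) + S.indicator 1 ((![s, pt34] : Fin 2 → I), (⊥ : I))) +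
        2⁻¹ * (S.indicator 1 ((![s, pt14] : Fin 2 → I), (⊤ : I)) + S.indicator 1 ((![s, ⊤] : Fin 2 → I), (⊤ : I)))) := by
  rw [fourAtomLaw_map_initLast]
  simp only [Measure.coe_smul, Measure.coe_add, Pi.smul_apply, Pi.add_apply, smul_eq_mul,
    Measure.dirac_apply' _ hS]

/-- Evaluation of `twoAtomLaw s s` on a measurable set. [this work] -/
theorem twoAtomLaw_self_apply (s : I) {S : Set (Fin 2 → I)} (hS : MeasurableSet S) :
    twoAtomLaw s s S = 2⁻¹ * (2⁻¹ * (S.indicator 1 (![s, ⊥] : Fin 2 → I) + S.indicator 1 (![s, pt34] : Fin 2 → I)) +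
      2⁻¹ * (S.indicator 1 (![s, pt14] : Fin 2 → I) + S.indicator 1 (![s, ⊤] : Fin 2 → I))) := by
  simp only [twoAtomLaw, Measure.coe_smul, Measure.coe_add, Pi.smul_apply, Pi.add_apply, smul_eq_mul,
    Measure.dirac_apply' _ hS]

/-- Second coordinates distinguish the four conditioning atoms. [folklore] -/
theorem vec2_ne_of_ne {s : I} {u v : I} (h : u ≠ v) : (![s, u] : Fin 2 → I) ≠ ![s, v] := fun e => by
  have := congrFun e 1
  exact h this

/-- `twoAtomLaw s s` gives mass `¼` to the atom `(s, ¾)`. [this work] -/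
theorem twoAtomLaw_self_singleton_pt34 (s : I) : twoAtomLaw s s {(![s, pt34] : Fin 2 → I)} = 2⁻¹ * 2⁻¹ := by
  rw [twoAtomLaw_self_apply s (measurableSet_singleton _)]
  rw [indicator_of_notMem (show (![s, ⊥] : Fin 2 → I) ∉ ({![s, pt34]} : Set (Fin 2 → I)) from
        fun h => vec2_ne_of_ne (ne_of_lt (lt_of_lt_of_le bot_lt_pt14 pt14_le_pt34)) (mem_singleton_iff.1 h)),
    indicator_of_mem (mem_singleton _),
    indicator_of_notMem (show (![s, pt14] : Fin 2 → I) ∉ ({![s, pt34]} : Set (Fin 2 → I)) from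
        fun h => vec2_ne_of_ne pt14_ne_pt34 (mem_singleton_iff.1 h)),
    indicator_of_notMem (show (![s, ⊤] : Fin 2 → I) ∉ ({![s, pt34]} : Set (Fin 2 → I)) from
        fun h => vec2_ne_of_ne (ne_of_gt pt34_lt_top) (mem_singleton_iff.1 h))]
  simp

/-- `twoAtomLaw s s` gives mass `¼` to the atom `(s, ¼)`. [this work] -/
theorem twoAtomLaw_self_singleton_pt14 (s : I) : twoAtomLaw s s {(![s, pt14] : Fin 2 → I)} = 2⁻¹ * 2⁻¹ := by
  rw [twoAtomLaw_self_apply s (measurableSet_singleton _)]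
  rw [indicator_of_notMem (show (![s, ⊥] : Fin 2 → I) ∉ ({![s, pt14]} : Set (Fin 2 → I)) from
        fun h => vec2_ne_of_ne (ne_of_lt bot_lt_pt14) (mem_singleton_iff.1 h)),
    indicator_of_notMem (show (![s, pt34] : Fin 2 → I) ∉ ({![s, pt14]} : Set (Fin 2 → I)) from
        fun h => vec2_ne_of_ne pt14_ne_pt34.symm (mem_singleton_iff.1 h)),
    indicator_of_mem (mem_singleton _),
    indicator_of_notMem (show (![s, ⊤] : Fin 2 → I) ∉ ({![s, pt14]} : Set (Fin 2 → I)) from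
        fun h => vec2_ne_of_ne (ne_of_gt pt14_lt_top) (mem_singleton_iff.1 h))]
  simp

/-- Any disintegration kernel of `X₂` given `(X₀, X₁)` under `fourAtomLaw s s` has `K((s,¾))([0,¼]) = 1` (the
conditional law there is `δ_0`). [this work] -/
theorem kernel_at_pt34 (s : I) {κ : Kernel (Fin 2 → I) I} [IsSFiniteKernel κ]
    (hdis : twoAtomLaw s s ⊗ₘ κ = (fourAtomLaw s s).map initLast) : κ ![s, pt34] (Iic pt14) = 1 := by
  have h := congrArg (fun ν : Measure ((Fin 2 → I) × I) => ν ({(![s, pt34] : Fin 2 → I)} ×ˢ Iic pt14)) hdis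
  rw [Measure.compProd_apply_prod (measurableSet_singleton _) measurableSet_Iic, lintegral_singleton,
    twoAtomLaw_self_singleton_pt34,
    fourAtomLaw_self_map_initLast_apply s ((measurableSet_singleton _).prod measurableSet_Iic)] at h
  rw [indicator_of_notMem (show ((![s, ⊥] : Fin 2 → I), (⊥ : I)) ∉ ({(![s, pt34] : Fin 2 → I)} ×ˢ Iic pt14) from
        fun hm => vec2_ne_of_ne (ne_of_lt (lt_of_lt_of_le bot_lt_pt14 pt14_le_pt34)) (mem_singleton_iff.1 hm.1)),
    indicator_of_mem (show ((![s, pt34] : Fin 2 → I), (⊥ : I)) ∈ ({(![s, pt34] : Fin 2 → I)} ×ˢ Iic pt14) from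
        ⟨mem_singleton _, (bot_le : (⊥ : I) ≤ pt14)⟩),
    indicator_of_notMem (show ((![s, pt14] : Fin 2 → I), (⊤ : I)) ∉ ({(![s, pt34] : Fin 2 → I)} ×ˢ Iic pt14) from
        fun hm => vec2_ne_of_ne pt14_ne_pt34 (mem_singleton_iff.1 hm.1)),
    indicator_of_notMem (show ((![s, ⊤] : Fin 2 → I), (⊤ : I)) ∉ ({(![s, pt34] : Fin 2 → I)} ×ˢ Iic pt14) from
        fun hm => not_le.2 pt14_lt_top hm.2)] at h
  have h' : κ ![s, pt34] (Iic pt14) * (2⁻¹ * 2⁻¹) = 1 * (2⁻¹ * 2⁻¹) := by simpa using h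
  have h2 : (2⁻¹ : ℝ≥0∞) ≠ 0 := by norm_num
  have h2' : (2⁻¹ : ℝ≥0∞) ≠ ⊤ := by norm_num
  exact (ENNReal.mul_left_inj (mul_ne_zero h2 h2) (ENNReal.mul_ne_top h2' h2')).1 h'

/-- Any disintegration kernel of `X₂` given `(X₀, X₁)` under `fourAtomLaw s s` has `K((s,¼))([0,¼]) = 0` (the
conditional law there is `δ_1`). [this work] -/
theorem kernel_at_pt14 (s : I) {κ : Kernel (Fin 2 → I) I} [IsSFiniteKernel κ]
    (hdis : twoAtomLaw s s ⊗ₘ κ = (fourAtomLaw s s).map initLast) : κ ![s, pt14] (Iic pt14) = 0 := by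
  have h := congrArg (fun ν : Measure ((Fin 2 → I) × I) => ν ({(![s, pt14] : Fin 2 → I)} ×ˢ Iic pt14)) hdis
  rw [Measure.compProd_apply_prod (measurableSet_singleton _) measurableSet_Iic, lintegral_singleton,
    twoAtomLaw_self_singleton_pt14,
    fourAtomLaw_self_map_initLast_apply s ((measurableSet_singleton _).prod measurableSet_Iic)] at h
  rw [indicator_of_notMem (show ((![s, ⊥] : Fin 2 → I), (⊥ : I)) ∉ ({(![s, pt14] : Fin 2 → I)} ×ˢ Iic pt14) from
        fun hm => vec2_ne_of_ne (ne_of_lt bot_lt_pt14) (mem_singleton_iff.1 hm.1)),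
    indicator_of_notMem (show ((![s, pt34] : Fin 2 → I), (⊥ : I)) ∉ ({(![s, pt14] : Fin 2 → I)} ×ˢ Iic pt14) from
        fun hm => vec2_ne_of_ne pt14_ne_pt34.symm (mem_singleton_iff.1 hm.1)),
    indicator_of_notMem (show ((![s, pt14] : Fin 2 → I), (⊤ : I)) ∉ ({(![s, pt14] : Fin 2 → I)} ×ˢ Iic pt14) from
        fun hm => not_le.2 pt14_lt_top hm.2),
    indicator_of_notMem (show ((![s, ⊤] : Fin 2 → I), (⊤ : I)) ∉ ({(![s, pt14] : Fin 2 → I)} ×ˢ Iic pt14) from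
        fun hm => not_le.2 pt14_lt_top hm.2)] at h
  have h' : κ ![s, pt14] (Iic pt14) * (2⁻¹ * 2⁻¹) = 0 := by simpa using h
  have h2 : (2⁻¹ : ℝ≥0∞) ≠ 0 := by norm_num
  rcases mul_eq_zero.1 h' with h'' | h''
  · exact h''
  · exact absurd h'' (mul_ne_zero h2 h2)

/-- **For `s = t` the four-atom law is NOT CIS** in the a.e.-kernel sense (hence admits no stochastically
increasing disintegration kernels of any kind): the conditioning atoms `(s,¼) ≤ (s,¾)` carry the conditional laws
`δ_1`, `δ_0` of `X₂` and form an atom of `μ^{(2)} ⊗ μ^{(2)}`. [this work] -/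
theorem not_isCISae_fourAtomLaw_self (s : I) : ¬ IsCISae 3 (fourAtomLaw s s) := by
  rintro ⟨-, κ, hκM, hdis, hmono⟩
  rw [fourAtomLaw_map_initLast_fst] at hdis hmono
  have hatom : (twoAtomLaw s s).prod (twoAtomLaw s s) {((![s, pt14] : Fin 2 → I), (![s, pt34] : Fin 2 → I))} ≠ 0 := by
    rw [← singleton_prod_singleton, Measure.prod_prod, twoAtomLaw_self_singleton_pt14, twoAtomLaw_self_singleton_pt34]
    have h2 : (2⁻¹ : ℝ≥0∞) ≠ 0 := by norm_num
    exact mul_ne_zero (mul_ne_zero h2 h2) (mul_ne_zero h2 h2)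
  have hp := of_ae_of_measure_singleton_ne_zero hmono hatom
  have hle : (![s, pt14] : Fin 2 → I) ≤ ![s, pt34] := fun i => by
    refine Fin.cases le_rfl (fun j => ?_) i
    fin_cases j; exact pt14_le_pt34
  have h := hp hle pt14
  change κ ![s, pt34] (Iic pt14) ≤ κ ![s, pt14] (Iic pt14) at h
  rw [kernel_at_pt34 s hdis, kernel_at_pt14 s hdis] at h
  exact absurd h (not_le.2 zero_lt_one)

end Self

/-! ### Weak convergence and the non-closure theorem -/

section Limit

/-- The integral of a bounded continuous function against `fourAtomLaw s t`. [this work] -/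
theorem integral_fourAtomLaw (s t : I) (f : (Fin 3 → I) →ᵇ ℝ) :
    ∫ x, f x ∂(fourAtomLaw s t) =
      2⁻¹ * (2⁻¹ * (f ![s, ⊥, ⊥] + f ![s, pt34, ⊥]) + 2⁻¹ * (f ![t, pt14, ⊤] + f ![t, ⊤, ⊤])) := by
  have h2 : (2⁻¹ : ℝ≥0∞) ≠ ⊤ := by norm_num
  have hA : Integrable f (Measure.dirac ![s, ⊥, ⊥] + Measure.dirac ![s, pt34, ⊥]) := f.integrable _
  have hB : Integrable f (Measure.dirac ![t, pt14, ⊤] + Measure.dirac ![t, ⊤, ⊤]) := f.integrable _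
  simp only [fourAtomLaw]
  rw [integral_smul_measure, integral_add_measure (hA.smul_measure h2) (hB.smul_measure h2), integral_smul_measure,
    integral_smul_measure, integral_add_measure (f.integrable _) (f.integrable _),
    integral_add_measure (f.integrable _) (f.integrable _), integral_dirac, integral_dirac, integral_dirac,
    integral_dirac]
  simp only [ENNReal.toReal_inv, ENNReal.toReal_ofNat, smul_eq_mul]

/-- `s ↦ (s, a, b)` is continuous. [folklore] -/
theorem continuous_vec3_left (a b : I) : Continuous fun s : I => (![s, a, b] : Fin 3 → I) := by
  refine continuous_pi fun i => ?_
  refine Fin.cases ?_ (fun j => ?_) i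
  · exact continuous_id
  · exact continuous_const

/-- The four-atom law as a `ProbabilityMeasure`. [this work] -/
def fourAtomPM (s t : I) : ProbabilityMeasure (Fin 3 → I) := ⟨fourAtomLaw s t, inferInstance⟩

/-- Coercion of `fourAtomPM`. [this work] -/
@[simp] theorem coe_fourAtomPM (s t : I) : ((fourAtomPM s t : ProbabilityMeasure (Fin 3 → I)) : Measure (Fin 3 → I)) =
    fourAtomLaw s t := rfl

/-- **Weak continuity of the family**: if `s_n → s` and `t_n → t` in `[0,1]` then `fourAtomLaw s_n t_n → fourAtomLaw s t`
weakly (as probability measures). [this work] -/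
theorem tendsto_fourAtomLaw {sq tq : ℕ → I} {s t : I} (hs : Tendsto sq atTop (𝓝 s)) (ht : Tendsto tq atTop (𝓝 t)) :
    Tendsto (fun n => fourAtomPM (sq n) (tq n)) atTop (𝓝 (fourAtomPM s t)) := by
  rw [ProbabilityMeasure.tendsto_iff_forall_integral_tendsto]
  intro f
  simp only [coe_fourAtomPM, integral_fourAtomLaw]
  have hc : ∀ (a b : I) {u : ℕ → I} {l : I}, Tendsto u atTop (𝓝 l) →
      Tendsto (fun n => f ![u n, a, b]) atTop (𝓝 (f ![l, a, b])) := fun a b u l hu =>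
    ((f.continuous.comp (continuous_vec3_left a b)).tendsto l).comp hu
  exact ((((hc ⊥ ⊥ hs).add (hc pt34 ⊥ hs)).const_mul _).add (((hc pt14 ⊤ ht).add (hc ⊤ ⊤ ht)).const_mul _)).const_mul _

/-- The moving threshold `t_n = 1/(n+1) ∈ [0,1]`. [this work] -/
def tSeq (n : ℕ) : I := ⟨1 / ((n : ℝ) + 1), by
  rw [Set.mem_Icc]
  refine ⟨by positivity, ?_⟩
  rw [div_le_one (by positivity)]
  linarith [n.cast_nonneg (α := ℝ)]⟩

/-- `t_n > 0`. [this work] -/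
theorem bot_lt_tSeq (n : ℕ) : (⊥ : I) < tSeq n := by
  change (0 : ℝ) < 1 / ((n : ℝ) + 1); positivity

/-- `t_n → 0`. [this work] -/
theorem tendsto_tSeq : Tendsto tSeq atTop (𝓝 ⊥) := by
  rw [tendsto_subtype_rng]
  exact tendsto_one_div_add_atTop_nhds_zero_nat

/-- **CIS (kernel sense) is not closed under weak convergence on `[0,1]³`**: the laws `fourAtomLaw 0 (1/(n+1))` are
`IsCISae 3` (with everywhere stochastically increasing kernels) and converge weakly to `fourAtomLaw 0 0`, which is not
`IsCISae 3`.  Contrast: Colangelo–Müller–Scarsini's Definition 4 IS weakly closed (their Thm. 5) — it is a different,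
weaker notion in dimension `≥ 3`. [this work] -/
theorem exists_isCISae_tendsto_not_isCISae :
    ∃ (μs : ℕ → ProbabilityMeasure (Fin 3 → I)) (μ : ProbabilityMeasure (Fin 3 → I)),
      (∀ n, IsCISae 3 (μs n : Measure (Fin 3 → I))) ∧ Tendsto μs atTop (𝓝 μ) ∧
        ¬ IsCISae 3 (μ : Measure (Fin 3 → I)) :=
  ⟨fun n => fourAtomPM ⊥ (tSeq n), fourAtomPM ⊥ ⊥,
    fun n => isCISae_fourAtomLaw (bot_lt_tSeq n), tendsto_fourAtomLaw tendsto_const_nhds tendsto_tSeq,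
    not_isCISae_fourAtomLaw_self ⊥⟩

end Limit

end Summit.CriticalPhenomena.PercolationContinuityZ3.Theorems.SahiCIS

end
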